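import Mathlib.Analysis.SpecialFunctions.Complex.LogBounds
import Literature.Probability.LatticeModels.ClusterExpansionKPBound
import HarnessLib

/-!
# KPL-A · the one-polymer log-increment of an abstract polymer gas, reality on the real Kotecký–Preiss segment, Möbius bookkeeping

Cell `ym3-torus` (rung R3 = continuum SU(2) Yang–Mills on `T³`; NOT `d = 4`, NOT infinite volume, NOT a mass gap, NOT the
Clay problem), crux `stmt-QuantumFields-20520` (`UnitScaleTilt.FluctuationComparisonRegPrIntL`), LINE g19-1
`Cruxes/FluctuationComparisonRegPrIntL/Lines/largefield_gas.lean` v2 (ideator `ym-r3-idea-1` g19): support for its abstract,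
gauge-free stub **KPL `stub_kpLogRep`** («a Kotecký–Preiss gas represents `log Ξ` as a V-local polymer representation with
FIELD-UNIFORM weights»).  The one ingredient of KPL not in the tree is the **alternating-sign majorant**
`‖Φ^T(w; C)‖ ≤ −Re Φ^T(−r; C)` of the truncated functional for `‖w‖ ≤ r` ([ScottSokal2005] Prop. 2.8), proved in the
sibling `…S2BetaKPLSignMajorant.lean` by the ONE-POLYMER DELETION INDUCTION; this file supplies the analytic and
combinatorial inputs of that induction, in the vocabulary of the tree's `Literature.Probability.LatticeModels.{PolymerGas,
ClusterExpansion, ClusterExpansionActivityPaths, ClusterExpansionKPBound}` (all PROVED there):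

* §1 reality: for REAL activities the partition function, its ray derivative and the Kotecký–Preiss logarithm are real
  (`im_polymerPartitionFunction_ofReal`, `im_polymerLogZ_ofReal`), and on a real KP volume `Z > 0` with
  `Real.log Z = Re log Z` (`re_polymerPartitionFunction_pos_of_kp`, `log_re_polymerPartitionFunction_of_kp`);
* §2 the ratio through the clusters touching a polymer, `Z(Bˣ)/Z(B) = exp(−Σ_{D ⊆ B, D ι x} Φ^T(D))`
  (`filter_div_eq_cexp_neg_touchSum`, a rewriting of the tree's [KP86] (5) `polymerPartitionFunction_sdiff_div_eq_exp`);
* §3 **the one-polymer log-increment** `log Z(B ∪ x) − log Z(B) = Log(1 + v_x Z(Bˣ)/Z(B))` with the PRINCIPAL branch, when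
  `‖t v_x Z(Bˣ; tv)/Z(B; tv)‖ < 1` along the ray `t ∈ [0,1]` (`polymerLogZ_insert_eq_add_clog`: the tree's log-increment identity
  `integral_div_eq_sub_of_exp_eq` for `ψ(t) = log Z(B; tv) + Log(1 + u(t))`);
* §4 Möbius bookkeeping: `Φ^T(C ∪ x) = Σ_{B ⊆ C} (−1)^{|C∖B|} (log Z(B ∪ x) − log Z(B))` (`truncatedWeight_insert_eq_sum`) and the
  UNMARKED extraction `Σ_{B ⊆ C} (−1)^{|C∖B|} exp(−Σ_{D ⊆ B, T D} g D) = Σ_{𝒟 ⊆ {D ⊆ C : T D}, ⋃𝒟 = C} Π_{D ∈ 𝒟} (e^{−g D} − 1)`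
  (`moebius_cexp_neg_sum_eq`, twin of the tree's marked `moebius_ite_mem_mul_cexp_eq`).

Everything is PROVED (0 sorry, no new definitions, no named facts).  HONEST: nothing here is a claim about Bałaban's
renormalisation group, about `FluctuationComparisonRegPrIntL`, `LargeFieldPolymerRepCan`, or YM₃ on `T³`.

References: R. Kotecký, D. Preiss, Comm. Math. Phys. 103 (1986) 491–498, Theorem p.492 (2),(4), Proposition (5) [KoteckyPreiss1986];
A. D. Scott, A. D. Sokal, J. Stat. Phys. 118 (2005) 1151–1261 (arXiv:cond-mat/0309352), Prop. 2.8 [ScottSokal2005];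
S. Friedli, Y. Velenik, *Statistical Mechanics of Lattice Systems* (2017), §5.4 [FriedliVelenik2017].
-/

noncomputable section

open Finset Filter Topology Set MeasureTheory intervalIntegral
open scoped BigOperators
open Literature.Probability.LatticeModels

namespace Summit.QuantumFields.YangMills.Theorems.FluctuationComparisonRegPrIntLS2BetaKPLIncrement

variable {P : Type*} [DecidableEq P] {inc : P → P → Prop} [DecidableRel inc]

/-! ## §1 Real activities: reality of `Z`, `Z'`, `log Z`; positivity on a real Kotecký–Preiss volume -/

/-- For real activities the polymer partition function is real. [folklore] -/
theorem im_polymerPartitionFunction_ofReal (f : P → ℝ) (Λ : Finset P) :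
    (polymerPartitionFunction inc (fun γ => ((f γ : ℝ) : ℂ)) Λ).im = 0 := by
  unfold polymerPartitionFunction
  rw [Complex.im_sum]
  refine Finset.sum_eq_zero fun A _ => ?_
  split_ifs
  · rw [← Complex.ofReal_prod, Complex.ofReal_im]
  · rfl

/-- For real activities the ray derivative of the partition function is real. [folklore] -/
theorem im_polymerRayDeriv_ofReal (f : P → ℝ) (Λ : Finset P) (t : ℝ) :
    (polymerRayDeriv inc (fun γ => ((f γ : ℝ) : ℂ)) Λ t).im = 0 := by
  unfold polymerRayDeriv
  rw [Complex.im_sum]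
  refine Finset.sum_eq_zero fun A _ => ?_
  rw [← Complex.ofReal_prod, ← Complex.ofReal_natCast, ← Complex.ofReal_pow, ← Complex.ofReal_mul,
    ← Complex.ofReal_mul, Complex.ofReal_im]

omit [DecidableEq P] in
/-- Scaling a real activity by a real ray parameter gives a real activity (syntactic bridge). [folklore] -/
theorem ray_ofReal_eq (f : P → ℝ) (t : ℝ) :
    (fun γ => (t : ℂ) * ((f γ : ℝ) : ℂ)) = fun γ => (((t * f γ : ℝ)) : ℂ) := by
  funext γ; push_cast; ring

/-- For real activities the Kotecký–Preiss logarithm `∫₀¹ Z'(t)/Z(t) dt` is real. [cite: KoteckyPreiss1986, §2 (definition of log 𝒵(L; Φ))] -/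
theorem im_polymerLogZ_ofReal (f : P → ℝ) (Λ : Finset P) :
    (polymerLogZ inc (fun γ => ((f γ : ℝ) : ℂ)) Λ).im = 0 := by
  unfold polymerLogZ
  have hfun : (fun t : ℝ => polymerRayDeriv inc (fun γ => ((f γ : ℝ) : ℂ)) Λ t /
      polymerPartitionFunction inc (fun γ => (t : ℂ) * ((f γ : ℝ) : ℂ)) Λ) =
      fun t : ℝ => ((((polymerRayDeriv inc (fun γ => ((f γ : ℝ) : ℂ)) Λ t).re /
        (polymerPartitionFunction inc (fun γ => (t : ℂ) * ((f γ : ℝ) : ℂ)) Λ).re : ℝ)) : ℂ) := by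
    funext t
    have h1 := (Complex.conj_eq_iff_re.1 (Complex.conj_eq_iff_im.2 (im_polymerRayDeriv_ofReal (inc := inc) f Λ t))).symm
    have h2 : (polymerPartitionFunction inc (fun γ => (t : ℂ) * ((f γ : ℝ) : ℂ)) Λ).im = 0 := by
      rw [ray_ofReal_eq]; exact im_polymerPartitionFunction_ofReal _ Λ
    have h2' := (Complex.conj_eq_iff_re.1 (Complex.conj_eq_iff_im.2 h2)).symm
    rw [Complex.ofReal_div, ← h1, ← h2']
  rw [hfun, intervalIntegral.integral_ofReal, Complex.ofReal_im]

/-- For real activities the partition function IS the real number `Re Z` (as a complex number). [folklore] -/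
theorem polymerPartitionFunction_ofReal_eq_re (f : P → ℝ) (B : Finset P) :
    polymerPartitionFunction inc (fun γ => ((f γ : ℝ) : ℂ)) B =
      (((polymerPartitionFunction inc (fun γ => ((f γ : ℝ) : ℂ)) B).re : ℝ) : ℂ) :=
  (Complex.conj_eq_iff_re.1 (Complex.conj_eq_iff_im.2 (im_polymerPartitionFunction_ofReal f B))).symm

omit [DecidableEq P] in
/-- The KP condition is inherited along the ray `t • v`, `t ∈ [0,1]`. [cite: KoteckyPreiss1986, §3 (the segment tΦ stays in the region (1))] -/
theorem isKPVolume_ray {v : P → ℂ} {a : P → ℝ} {L : Finset P} (hKP : IsKPVolume inc v a L) {t : ℝ}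
    (ht : t ∈ Set.Icc (0 : ℝ) 1) : IsKPVolume inc (fun γ => (t : ℂ) * v γ) a L := fun γ hγ => by
  refine le_trans (Finset.sum_le_sum fun γ' _ => ?_) (hKP γ hγ)
  unfold kpTerm
  refine mul_le_mul_of_nonneg_right ?_ (Real.exp_nonneg _)
  rw [norm_mul, Complex.norm_real, Real.norm_eq_abs, abs_of_nonneg ht.1]
  exact mul_le_of_le_one_left (norm_nonneg _) ht.2

/-- The ray derivative of the ZERO activity vanishes. [folklore] -/
theorem polymerRayDeriv_const_zero (B : Finset P) (s : ℝ) :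
    polymerRayDeriv inc (fun _ : P => (0 : ℂ)) B s = 0 := by
  unfold polymerRayDeriv
  refine Finset.sum_eq_zero fun X _ => ?_
  rcases X.eq_empty_or_nonempty with h | h
  · subst h; simp
  · obtain ⟨γ, hγ⟩ := h
    rw [Finset.prod_eq_zero hγ rfl, mul_zero]

/-- The Kotecký–Preiss logarithm of the ZERO activity vanishes. [folklore] -/
theorem polymerLogZ_const_zero (B : Finset P) :
    polymerLogZ inc (fun _ : P => (0 : ℂ)) B = 0 := by
  unfold polymerLogZ
  simp only [polymerRayDeriv_const_zero, zero_div, intervalIntegral.integral_zero]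

/-- A complex number of norm `< 1` shifted by `1` lies in the slit plane. [folklore] -/
theorem one_add_mem_slitPlane_of_norm_lt_one {u : ℂ} (hu : ‖u‖ < 1) : 1 + u ∈ Complex.slitPlane := by
  rw [Complex.mem_slitPlane_iff]
  left
  have h := Complex.abs_re_le_norm u
  rw [Complex.add_re, Complex.one_re]
  have : -‖u‖ ≤ u.re := by
    have := neg_abs_le (u.re); linarith
  linarith

section RealKP

variable [Std.Refl inc] [Std.Symm inc]

/-- **Positivity on a real Kotecký–Preiss volume.** If real activities obey the finite-volume KP condition on `L`, every
sub-volume has `Z = exp(log Z)` with a REAL logarithm, hence `Re Z = exp(Re log Z) > 0`. [cite: KoteckyPreiss1986, Theorem p. 492 (𝒵 ≠ 0 and log 𝒵 on the KP region)] -/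
theorem re_polymerPartitionFunction_eq_exp_of_kp {f : P → ℝ} {a : P → ℝ} {L B : Finset P}
    (hKP : IsKPVolume inc (fun γ => ((f γ : ℝ) : ℂ)) a L) (hB : B ⊆ L) :
    (polymerPartitionFunction inc (fun γ => ((f γ : ℝ) : ℂ)) B).re =
      Real.exp (polymerLogZ inc (fun γ => ((f γ : ℝ) : ℂ)) B).re := by
  have h := exp_polymerLogZ_of_kp hKP hB
  rw [(Complex.conj_eq_iff_re.1 (Complex.conj_eq_iff_im.2 (im_polymerLogZ_ofReal (inc := inc) f B))).symm, ← Complex.ofReal_exp] at h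
  rw [← h, Complex.ofReal_re]

/-- On a real KP volume every sub-volume partition function is a positive real. [cite: KoteckyPreiss1986, Theorem p. 492] -/
theorem re_polymerPartitionFunction_pos_of_kp {f : P → ℝ} {a : P → ℝ} {L B : Finset P}
    (hKP : IsKPVolume inc (fun γ => ((f γ : ℝ) : ℂ)) a L) (hB : B ⊆ L) :
    0 < (polymerPartitionFunction inc (fun γ => ((f γ : ℝ) : ℂ)) B).re := by
  rw [re_polymerPartitionFunction_eq_exp_of_kp hKP hB]; exact Real.exp_pos _

/-- On a real KP volume, `Real.log (Re Z) = Re (log Z)` for the Kotecký–Preiss logarithm. [cite: KoteckyPreiss1986, Theorem p. 492 (2)] -/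
theorem log_re_polymerPartitionFunction_of_kp {f : P → ℝ} {a : P → ℝ} {L B : Finset P}
    (hKP : IsKPVolume inc (fun γ => ((f γ : ℝ) : ℂ)) a L) (hB : B ⊆ L) :
    Real.log (polymerPartitionFunction inc (fun γ => ((f γ : ℝ) : ℂ)) B).re =
      (polymerLogZ inc (fun γ => ((f γ : ℝ) : ℂ)) B).re := by
  rw [re_polymerPartitionFunction_eq_exp_of_kp hKP hB, Real.log_exp]

end RealKP

/-! ## §2 The ratio through the clusters touching a polymer ([KP86] (5)) -/

section Ratio

variable [Std.Refl inc] [Std.Symm inc]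

/-- **[KP86] (5) at one polymer.** On a KP volume `B`, the partition function of the polymers of `B` compatible with `x`,
divided by `Z(B)`, is `exp(−Σ_{D ⊆ B, D ι x} Φ^T(D))`. [cite: KoteckyPreiss1986, Proposition p. 494 (5)] -/
theorem filter_div_eq_cexp_neg_touchSum {v : P → ℂ} {a : P → ℝ} {B : Finset P} (hKP : IsKPVolume inc v a B) (x : P) :
    polymerPartitionFunction inc v (B.filter fun γ' => ¬ inc x γ') / polymerPartitionFunction inc v B =
      Complex.exp (-∑ D ∈ B.powerset with KPTouches inc D x, truncatedWeight inc v D) := by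
  have h5 := polymerPartitionFunction_sdiff_div_eq_exp (inc := inc) (w := v) (a := a) (Λ := B)
    (D := B.filter fun γ' => inc x γ') hKP
  have hsd : B \ B.filter (fun γ' => inc x γ') = B.filter fun γ' => ¬ inc x γ' := by
    ext γ'; simp only [Finset.mem_sdiff, Finset.mem_filter]; tauto
  rw [hsd] at h5
  rw [h5]
  congr 2
  refine Finset.sum_congr (Finset.filter_congr fun D hD => ?_) fun _ _ => rfl
  have hDB : D ⊆ B := Finset.mem_powerset.1 hD
  constructor
  · rintro ⟨y, hy⟩
    rw [Finset.mem_inter, Finset.mem_filter] at hy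
    exact ⟨y, hy.1, Std.Symm.symm _ _ hy.2.2⟩
  · rintro ⟨y, hyD, hy⟩
    exact ⟨y, Finset.mem_inter.2 ⟨hyD, Finset.mem_filter.2 ⟨hDB hyD, Std.Symm.symm _ _ hy⟩⟩⟩

end Ratio

/-! ## §3 The one-polymer log-increment with the principal branch -/

section Increment

variable [Std.Refl inc] [Std.Symm inc]

/-- **THE ONE-POLYMER LOG-INCREMENT (principal branch).** On a KP volume `L ∋ x`, `B ⊆ L ∖ x`, write
`u(t) := t·v(x)·Z(Bˣ; t v)/Z(B; t v)` (`Bˣ` = the polymers of `B` compatible with `x`).  If `‖u(t)‖ < 1` for `t ∈ [0,1]`, then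
`log Z(B ∪ x; v) = log Z(B; v) + Log(1 + u(1))` for the Kotecký–Preiss logarithms and the principal `Log`: the function
`ψ(t) = log Z(B; tv) + Log(1 + u(t))` is a continuous logarithm of `Z(B ∪ x; tv) = Z(B; tv) + t v(x) Z(Bˣ; tv)` vanishing at
`t = 0`, and the tree's log-increment identity integrates `Z'/Z`. [cite: KoteckyPreiss1986, §2 (definition of log 𝒵) and §3 (13)] -/
theorem polymerLogZ_insert_eq_add_clog {v : P → ℂ} {a : P → ℝ} {L : Finset P} (hKP : IsKPVolume inc v a L)
    {x : P} {B : Finset P} (hxB : insert x B ⊆ L) (hx : x ∉ B)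
    (hsmall : ∀ t ∈ Set.Icc (0 : ℝ) 1,
      ‖(t : ℂ) * v x * (polymerPartitionFunction inc (fun γ => (t : ℂ) * v γ) (B.filter fun γ' => ¬ inc x γ') /
        polymerPartitionFunction inc (fun γ => (t : ℂ) * v γ) B)‖ < 1) :
    polymerLogZ inc v (insert x B) = polymerLogZ inc v B +
      Complex.log (1 + v x * (polymerPartitionFunction inc v (B.filter fun γ' => ¬ inc x γ') /
        polymerPartitionFunction inc v B)) := by
  have hBL : B ⊆ L := (Finset.subset_insert x B).trans hxB
  -- notation along the ray
  set Bx : Finset P := B.filter fun γ' => ¬ inc x γ' with hBx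
  set Zr : Finset P → ℝ → ℂ := fun A t => polymerPartitionFunction inc (fun γ => (t : ℂ) * v γ) A with hZr
  set u : ℝ → ℂ := fun t => (t : ℂ) * v x * (Zr Bx t / Zr B t) with hu
  set ψ : ℝ → ℂ := fun t => polymerLogZ inc (fun γ => (t : ℂ) * v γ) B + Complex.log (1 + u t) with hψ
  have hKPt : ∀ t ∈ Set.Icc (0 : ℝ) 1, IsKPVolume inc (fun γ => (t : ℂ) * v γ) a L := fun t ht =>
    isKPVolume_ray hKP ht
  have hne : ∀ A ⊆ L, ∀ t ∈ Set.Icc (0 : ℝ) 1, Zr A t ≠ 0 := fun A hA t ht =>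
    polymerPartitionFunction_ne_zero_of_kp (hKPt t ht) hA
  have hZc : ∀ A, Continuous (Zr A) := fun A => continuous_polymerPartitionFunction_ray v A
  -- continuity of `u` and of `Log (1 + u)` on `[0,1]`
  have huc : ContinuousOn u (Set.Icc 0 1) := by
    refine ((Complex.continuous_ofReal.continuousOn.mul continuousOn_const).mul ?_)
    exact (hZc Bx).continuousOn.div (hZc B).continuousOn (hne B hBL)
  have hlogc : ContinuousOn (fun t => Complex.log (1 + u t)) (Set.Icc 0 1) := by
    refine ContinuousOn.clog (continuousOn_const.add huc) fun t ht => ?_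
    exact one_add_mem_slitPlane_of_norm_lt_one (hsmall t ht)
  -- continuity of `t ↦ log Z(B; tv)`
  have hcube : ∀ c ∈ {c : P → ℝ | ∀ δ, c δ ∈ Set.Icc (0 : ℝ) 1}, ∀ s ∈ Set.Icc (0 : ℝ) 1,
      polymerPartitionFunction inc (fun δ => (s : ℂ) * scaledActivity v c δ) B ≠ 0 :=
    fun c hc s hs => polymerPartitionFunction_scaled_ne_zero_of_kp hKP hBL hc hs
  have hmaps : Set.MapsTo (fun t : ℝ => fun _ : P => t) (Set.Icc (0 : ℝ) 1)
      {c : P → ℝ | ∀ δ, c δ ∈ Set.Icc (0 : ℝ) 1} := fun t ht _ => ht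
  have hlogZc : ContinuousOn (fun t : ℝ => polymerLogZ inc (fun γ => (t : ℂ) * v γ) B) (Set.Icc 0 1) := by
    have h := (continuousOn_polymerLogZ_scaled (inc := inc) v B hcube).comp
      (continuous_pi fun _ => continuous_id).continuousOn hmaps
    exact h
  have hψc : ContinuousOn ψ (Set.Icc 0 1) := hlogZc.add hlogc
  -- `exp ψ = Z(B ∪ x; t v)`
  have hexp : ∀ t ∈ Set.Icc (0 : ℝ) 1, Complex.exp (ψ t) = Zr (insert x B) t := by
    intro t ht
    have h1 : Complex.exp (polymerLogZ inc (fun γ => (t : ℂ) * v γ) B) = Zr B t :=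
      exp_polymerLogZ_of_kp (hKPt t ht) hBL
    have h1u : 1 + u t ≠ 0 := Complex.slitPlane_ne_zero (one_add_mem_slitPlane_of_norm_lt_one (hsmall t ht))
    have hZB : polymerPartitionFunction inc (fun γ => (t : ℂ) * v γ) B ≠ 0 := hne B hBL t ht
    simp only [hψ]
    rw [Complex.exp_add, h1, Complex.exp_log h1u]
    simp only [hu, hZr, hBx]
    rw [polymerPartitionFunction_insert inc_symm_of_symm (fun γ => (t : ℂ) * v γ) hx]
    rw [mul_add, mul_one]
    congr 1
    rw [mul_comm, mul_assoc, div_mul_cancel₀ _ hZB]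
  -- the log-increment identity
  have hderiv : ∀ t ∈ Set.Icc (0 : ℝ) 1, HasDerivAt (Zr (insert x B)) (polymerRayDeriv inc v (insert x B) t) t :=
    fun t _ => hasDerivAt_polymerPartitionFunction_ray v (insert x B) t
  have hincr := integral_div_eq_sub_of_exp_eq zero_le_one hψc hderiv
    (continuous_polymerRayDeriv v (insert x B)).continuousOn (hne (insert x B) hxB) hexp
  -- evaluate
  have hL : polymerLogZ inc v (insert x B) = ψ 1 - ψ 0 := by rw [← hincr]; rfl
  have hψ0 : ψ 0 = 0 := by
    simp only [hψ, hu]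
    have h0 : (fun γ => ((0 : ℝ) : ℂ) * v γ) = fun _ => (0 : ℂ) := funext fun _ => by simp
    rw [h0, polymerLogZ_const_zero, Complex.ofReal_zero, zero_mul, zero_mul, add_zero, Complex.log_one, add_zero]
  have hψ1 : ψ 1 = polymerLogZ inc v B + Complex.log (1 + v x * (polymerPartitionFunction inc v Bx /
      polymerPartitionFunction inc v B)) := by
    simp only [hψ, hu, hZr]
    have hv1 : (fun γ => ((1 : ℝ) : ℂ) * v γ) = v := by funext γ; simp
    rw [hv1, Complex.ofReal_one, one_mul]
  rw [hL, hψ0, sub_zero, hψ1]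

end Increment

/-! ## §4 Möbius bookkeeping: deleting one polymer, and the unmarked extraction -/

/-- **Deleting one polymer in the Möbius transform**: for `x ∉ C`,
`Φ^T(C ∪ x) = Σ_{B ⊆ C} (−1)^{|C∖B|} (log Z(B ∪ x) − log Z(B))`. [cite: KoteckyPreiss1986, (3)] -/
theorem truncatedWeight_insert_eq_sum (v : P → ℂ) {C : Finset P} {x : P} (hx : x ∉ C) :
    truncatedWeight inc v (insert x C) =
      ∑ B ∈ C.powerset, (-1 : ℂ) ^ (C \ B).card * (polymerLogZ inc v (insert x B) - polymerLogZ inc v B) := by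
  unfold truncatedWeight
  rw [Finset.sum_powerset_insert hx, ← Finset.sum_add_distrib]
  refine Finset.sum_congr rfl fun B hB => ?_
  have hBC : B ⊆ C := Finset.mem_powerset.1 hB
  have hxB : x ∉ B := fun h => hx (hBC h)
  have h1 : insert x C \ B = insert x (C \ B) := by
    ext y; simp only [Finset.mem_sdiff, Finset.mem_insert]
    constructor
    · rintro ⟨h | h, hy⟩
      · exact Or.inl h
      · exact Or.inr ⟨h, hy⟩
    · rintro (h | ⟨h, hy⟩)
      · exact ⟨Or.inl h, h ▸ hxB⟩
      · exact ⟨Or.inr h, hy⟩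
  have h2 : insert x C \ insert x B = C \ B := by
    ext y; simp only [Finset.mem_sdiff, Finset.mem_insert, not_or]
    constructor
    · rintro ⟨h | h, hyx, hyB⟩
      · exact absurd h hyx
      · exact ⟨h, hyB⟩
    · rintro ⟨h, hyB⟩
      exact ⟨Or.inr h, fun hyx => hx (hyx ▸ h), hyB⟩
  have hxCB : x ∉ C \ B := fun h => hx (Finset.mem_sdiff.1 h).1
  rw [h1, h2, Finset.card_insert_of_notMem hxCB, pow_succ]
  ring

/-- **Unmarked Möbius extraction**: for any `g` and any selection `T` of subsets,
`Σ_{B ⊆ C} (−1)^{|C∖B|} exp(−Σ_{D ⊆ B, T D} g(D)) = Σ_{𝒟 ⊆ {D ⊆ C : T D}, ⋃𝒟 = C} Π_{D ∈ 𝒟} (e^{−g(D)} − 1)` (write `e^{−g} = 1 + h`,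
expand the product, extract the families with support exactly `C` by `Σ_{B ⊆ C} (−1)^{|C∖B|} 1[U ⊆ B] = 1[U = C]`). [folklore] -/
theorem moebius_cexp_neg_sum_eq (g : Finset P → ℂ) (T : Finset P → Prop) [DecidablePred T] (C : Finset P) :
    ∑ B ∈ C.powerset, (-1 : ℂ) ^ (C \ B).card * Complex.exp (-∑ D ∈ B.powerset with T D, g D) =
      ∑ 𝒟 ∈ (C.powerset.filter T).powerset,
        if 𝒟.biUnion id = C then ∏ D ∈ 𝒟, (Complex.exp (-g D) - 1) else 0 := by
  -- expand each exponential over the families of `T`-subsets of `B`, re-indexed inside `C`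
  have hexp : ∀ B ∈ C.powerset, Complex.exp (-∑ D ∈ B.powerset with T D, g D) =
      ∑ 𝒟 ∈ (C.powerset.filter T).powerset,
        if 𝒟.biUnion id ⊆ B then ∏ D ∈ 𝒟, (Complex.exp (-g D) - 1) else 0 := by
    intro B hB
    have hBC : B ⊆ C := Finset.mem_powerset.1 hB
    rw [← Finset.sum_neg_distrib, Complex.exp_sum]
    have h1 : ∏ D ∈ B.powerset.filter T, Complex.exp (-g D) =
        ∏ D ∈ B.powerset.filter T, (1 + (Complex.exp (-g D) - 1)) :=
      Finset.prod_congr rfl fun D _ => by ring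
    rw [h1, Finset.prod_one_add, ← Finset.sum_filter]
    refine Finset.sum_congr ?_ fun 𝒟 _ => rfl
    ext 𝒟
    simp only [Finset.mem_powerset, Finset.mem_filter, Finset.biUnion_subset, id]
    constructor
    · intro h
      refine ⟨fun D hD => ?_, fun D hD => ?_⟩
      · have := Finset.mem_filter.1 (h hD)
        exact Finset.mem_filter.2 ⟨Finset.mem_powerset.2 ((Finset.mem_powerset.1 this.1).trans hBC), this.2⟩
      · exact Finset.mem_powerset.1 (Finset.mem_filter.1 (h hD)).1
    · rintro ⟨h1, h3⟩ D hD
      exact Finset.mem_filter.2 ⟨Finset.mem_powerset.2 (h3 D hD), (Finset.mem_filter.1 (h1 hD)).2⟩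
  rw [Finset.sum_congr rfl fun B hB => by rw [hexp B hB, Finset.mul_sum]]
  rw [Finset.sum_comm]
  refine Finset.sum_congr rfl fun 𝒟 _ => ?_
  have key := sum_powerset_neg_one_pow_card_sdiff_ite_subset (M := ℂ) (𝒟.biUnion id) C
  calc ∑ B ∈ C.powerset, (-1 : ℂ) ^ (C \ B).card *
        (if 𝒟.biUnion id ⊆ B then ∏ D ∈ 𝒟, (Complex.exp (-g D) - 1) else 0)
      = (∏ D ∈ 𝒟, (Complex.exp (-g D) - 1)) * ∑ B ∈ C.powerset, (-1 : ℂ) ^ (C \ B).card *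
          (if 𝒟.biUnion id ⊆ B then 1 else 0) := by
        rw [Finset.mul_sum]
        refine Finset.sum_congr rfl fun B _ => ?_
        split_ifs <;> ring
    _ = if 𝒟.biUnion id = C then ∏ D ∈ 𝒟, (Complex.exp (-g D) - 1) else 0 := by
        rw [key]
        split_ifs <;> simp

end Summit.QuantumFields.YangMills.Theorems.FluctuationComparisonRegPrIntLS2BetaKPLIncrement

end
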